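import Literature.MathematicalPhysics.QuantumLattice.GermMarkovSpectralCriterionCounterexample
import Literature.Probability.Process.GaussianCondExp
import Literature.Analysis.InnerProduct.GramIsometry
import HarnessLib

/-!
# Refutation of `InvSpectralDensityPolynomialOfGermMarkov` (Erratum, machine-checked)

THEOREM-ONLY file (no named facts).  Main result:

* `not_InvSpectralDensityPolynomialOfGermMarkov : ¬ InvSpectralDensityPolynomialOfGermMarkov` —
  the germ-form transcription of Rozanov's spectral criterion vendored in
  `GermMarkovSpectralCriterion.lean` is FALSE as written (see the Erratum there: Rozanov 1982,
  Ch. 3 §2.3 is stated for his *collar* Markov property (R) = Ch. 2 §1.3 (1.26)–(1.27), §3.3 (3.10);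
  the vendored germ form (K) = (1.28)/(3.16) at balls is strictly weaker).

Since the verdict clean-up of 2026-08-17 the refuted record is kept verbatim in
`GermMarkovSpectralCriterion.lean` under `@[deprecated]` (it cannot be deleted while this
refutation names it; the corrected statement is `InvSpectralDensityPolynomialOfCollarMarkov`
there), which is why `linter.deprecated` is switched off for
`not_InvSpectralDensityPolynomialOfGermMarkov` alone.

The counterexample is the centred Gaussian law `μ` on `𝒮'(ℝ¹)` with the local covariance
`E[ω(u)ω(v)] = ∫ u v + (4π²)⁻¹ ∫ u' v'`, i.e. spectral density `φ(ξ) = 1 + ‖ξ‖²`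
(`exists_counterexampleLaw_one`, by the tree's Minlos theorem).  This file supplies the two
remaining hypotheses of the fact for this law and assembles the contradiction with
`inv_one_add_norm_sq_ne_eval` (`1/φ` is not a polynomial):

* `integral_mul_add_lineDeriv_eq_spectral` — the spectral form of the covariance (Plancherel for
  Schwartz functions, Mathlib `SchwartzMap.integral_inner_fourier_fourier`, and
  `𝓕(∂u) = 2πi⟨ξ, e₀⟩ 𝓕u`, Mathlib `SchwartzMap.fourier_lineDerivOp_eq`).
* `condIndepCondExp_germSigma_ball` — the germ-Markov hypothesis (K) at EVERY ball
  `B = (c - r, c + r)`: `𝒜₊(∂B)` splits `𝒜₊(B̄)` and `𝒜₊(Bᶜ)`.  Proof (Rozanov 1982, Ch. 2 §3.1,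
  §3.3, the Gaussian dictionary between σ-algebras `𝒜(S)` and Gaussian spaces `H(S)`):
  1. the evaluation process `ω ↦ ω(u)` is a centred Gaussian linear process
     (`isGaussianLinearProcess_evalProcess`), so the tree's Gaussian germ machinery
     (`Literature/Probability/Process/GaussianGermSigma.lean`, `GaussianCondExp.lean`) applies;
  2. the Gram identity `E[ω(u)ω(v)] = ⟪(u, u'/2π), (v, v'/2π)⟫_{L² ⊕ L²}` gives, by the lurking
     isometry (`Literature.Analysis.InnerProduct.exists_clm_of_gram_eq`), an isometric model
     `T : H(ℝ) → L² ⊕ L²` of the Gaussian space in which `H(U)` consists of pairs vanishing a.e.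
     off `U` (`space_realSupportedIn_le_comap`), hence `H₊(A)` of pairs vanishing a.e. off
     `closure A` (`h1Model_germSpace_vanishing`);
  3. `B̄ ∩ Bᶜ = ∂B = {c ± r}` is Lebesgue-null, so `H₊(B̄) ⊥ H₊(Bᶜ)` (`germSpace_orthogonal`);
  4. orthogonal germ spaces have INDEPENDENT germ σ-algebras
     (`indep_iInf_sigma_of_germSpace_orthogonal`: indicators of germ events lie in the closed span
     of the germ characters `e^{iη}`, `η ∈ H₊` — the tree's `indicatorConstLp_mem_germExpSpan` —
     on which `E[FG] = E[F]E[G]` since orthogonal jointly Gaussian variables are independent);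
  5. independent σ-algebras split over any common sub-σ-algebra, here `𝒜₊(∂B) ≤ 𝒜₊(B̄), 𝒜₊(Bᶜ)`,
     which is then trivial (`condIndepCondExp_of_indep_of_le`).

## References

* Yu. A. Rozanov, *Markov Random Fields*, Springer 1982, Ch. 2 §1.1, §1.3 (1.26)–(1.28), §3.1,
  §3.3 (3.10), (3.16); Ch. 3 §2.3. [Rozanov1982]
* S. Janson, *Gaussian Hilbert Spaces*, CUP 1997, Ch. 1, Thm 9.1. [Janson1997]
-/

noncomputable section

open MeasureTheory ProbabilityTheory Filter Complex
open scoped ENNReal InnerProductSpace Topology SchwartzMap ComplexConjugate FourierTransform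

namespace Literature.MathematicalPhysics.QuantumLattice

open Literature.Probability.Process

/-! ### The spectral form of the counterexample covariance (`d = 1`) -/

section Spectral

open scoped LineDeriv

/-- The line `ℝ¹` as a Euclidean space. [folklore] -/
private abbrev E1' : Type := EuclideanSpace ℝ (Fin 1)

/-- The basis direction of `ℝ¹`. [folklore] -/
private abbrev e0' : E1' := EuclideanSpace.single (0 : Fin 1) (1 : ℝ)

/-- In `ℝ¹`, `‖ξ‖² = ⟪ξ, e₀⟫²`. [folklore] -/
theorem norm_sq_eq_inner_single_sq (ξ : E1') : ‖ξ‖ ^ 2 = ⟪ξ, e0'⟫_ℝ ^ 2 := by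
  rw [EuclideanSpace.real_norm_sq_eq, Fin.sum_univ_one, EuclideanSpace.inner_single_right]
  simp

/-- Complexification of real test functions commutes with line derivatives. [folklore] -/
theorem lineDerivOp_ofRealTest (u : 𝓢(E1', ℝ)) (m : E1') :
    ∂_{m} (ofRealTest u) = ofRealTest (∂_{m} u) := by
  ext x
  rw [SchwartzMap.lineDerivOp_apply_eq_fderiv, ofRealTest_apply,
    SchwartzMap.lineDerivOp_apply_eq_fderiv]
  have h : HasFDerivAt (fun y => ((u y : ℝ) : ℂ)) (Complex.ofRealCLM.comp (fderiv ℝ u x)) x :=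
    Complex.ofRealCLM.hasFDerivAt.comp x (u.hasFDerivAt x)
  change fderiv ℝ (fun y => ((u y : ℝ) : ℂ)) x m = _
  rw [h.fderiv]
  rfl

/-- `ξ ↦ ⟪f ξ, g ξ⟫_ℂ` is integrable for Schwartz `f, g`. [folklore] -/
theorem integrable_inner_schwartz (f g : 𝓢(E1', ℂ)) :
    Integrable (fun ξ => ⟪f ξ, g ξ⟫_ℂ) := by
  have h : (fun ξ => ⟪f ξ, g ξ⟫_ℂ) = fun ξ => conj (f ξ) * g ξ := by
    funext ξ; exact RCLike.inner_apply' _ _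
  rw [h]
  refine g.integrable.bdd_mul (c := SchwartzMap.seminorm ℝ 0 0 f) ?_ ?_
  · exact (Complex.continuous_conj.comp f.continuous).aestronglyMeasurable
  · exact Filter.Eventually.of_forall fun ξ => by
      rw [RCLike.norm_conj]
      exact SchwartzMap.norm_le_seminorm ℝ f ξ

/-- **Spectral form of the counterexample covariance (`d = 1`).**  By Plancherel and
`𝓕(∂u)(ξ) = 2πi⟨ξ, e₀⟩ 𝓕u(ξ)`: `∫ u v + (4π²)⁻¹ ∫ (∂u)(∂v) = Re ∫ (1 + ‖ξ‖²) 𝓕u(ξ) conj(𝓕v(ξ)) dξ`,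
i.e. the local `H¹`-type form `counterexampleForm` is the covariance with spectral density
`φ(ξ) = 1 + ‖ξ‖²` in Mathlib's Fourier convention. [folklore] -/
theorem integral_mul_add_lineDeriv_eq_spectral (u v : 𝓢(E1', ℝ)) :
    (∫ x, u x * v x) + (4 * Real.pi ^ 2)⁻¹ *
        ∫ x, (∂_{e0'} u : 𝓢(E1', ℝ)) x * (∂_{e0'} v : 𝓢(E1', ℝ)) x =
      (∫ ξ, (((1 + ‖ξ‖ ^ 2 : ℝ)) : ℂ) *
        (𝓕 (fun x => ((u x : ℝ) : ℂ)) ξ *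
          (starRingEnd ℂ) (𝓕 (fun x => ((v x : ℝ) : ℂ)) ξ))).re := by
  set uc : 𝓢(E1', ℂ) := ofRealTest u with huc
  set vc : 𝓢(E1', ℂ) := ofRealTest v with hvc
  have hu : (fun x => ((u x : ℝ) : ℂ)) = ⇑uc := rfl
  have hv : (fun x => ((v x : ℝ) : ℂ)) = ⇑vc := rfl
  rw [hu, hv, ← SchwartzMap.fourier_coe, ← SchwartzMap.fourier_coe]
  have hgr : (fun x : E1' => ⟪x, e0'⟫_ℝ).HasTemperateGrowth :=
    ((innerSL ℝ).flip e0').hasTemperateGrowth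
  have hk : (((4 * Real.pi ^ 2)⁻¹ : ℝ) : ℂ) * (2 * (Real.pi : ℂ) * Complex.I) *
      (2 * (Real.pi : ℂ) * Complex.I) = -1 := by
    have hI : Complex.I * Complex.I = -1 := Complex.I_mul_I
    have h4 : (((4 * Real.pi ^ 2)⁻¹ : ℝ) : ℂ) * (4 * (Real.pi : ℂ) ^ 2) = 1 := by
      have h : (4 * Real.pi ^ 2)⁻¹ * (4 * Real.pi ^ 2) = (1 : ℝ) :=
        inv_mul_cancel₀ (by positivity)
      exact_mod_cast h
    linear_combination ((((4 * Real.pi ^ 2)⁻¹ : ℝ) : ℂ) * (4 * (Real.pi : ℂ) ^ 2)) * hI - h4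
  -- pointwise identity of the integrands
  have hpt : ∀ ξ : E1', (((1 + ‖ξ‖ ^ 2 : ℝ)) : ℂ) * (𝓕 uc ξ * conj (𝓕 vc ξ)) =
      ⟪𝓕 vc ξ, 𝓕 uc ξ⟫_ℂ +
        (((4 * Real.pi ^ 2)⁻¹ : ℝ) : ℂ) * ⟪𝓕 (∂_{e0'} vc) ξ, 𝓕 (∂_{e0'} uc) ξ⟫_ℂ := by
    intro ξ
    rw [SchwartzMap.fourier_lineDerivOp_eq, SchwartzMap.fourier_lineDerivOp_eq,
      norm_sq_eq_inner_single_sq]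
    simp only [smul_apply, SchwartzMap.smulLeftCLM_apply_apply hgr,
      RCLike.inner_apply', smul_eq_mul, Complex.real_smul, map_mul, Complex.conj_ofReal,
      Complex.conj_I, map_ofNat, Complex.ofReal_add, Complex.ofReal_one, Complex.ofReal_pow]
    linear_combination ((⟪ξ, e0'⟫_ℝ : ℂ) ^ 2 * 𝓕 uc ξ * conj (𝓕 vc ξ)) * hk
  simp_rw [hpt]
  rw [integral_add (integrable_inner_schwartz _ _) ((integrable_inner_schwartz _ _).const_mul _),
    integral_const_mul, SchwartzMap.integral_inner_fourier_fourier,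
    SchwartzMap.integral_inner_fourier_fourier, lineDerivOp_ofRealTest, lineDerivOp_ofRealTest]
  have h1 : (fun x => ⟪vc x, uc x⟫_ℂ) = fun x => ((u x * v x : ℝ) : ℂ) := by
    funext x
    rw [RCLike.inner_apply']
    simp [uc, vc, mul_comm]
  have h2 : (fun x => ⟪ofRealTest (∂_{e0'} v) x, ofRealTest (∂_{e0'} u) x⟫_ℂ) =
      fun x => (((∂_{e0'} u : 𝓢(E1', ℝ)) x * (∂_{e0'} v : 𝓢(E1', ℝ)) x : ℝ) : ℂ) := by
    funext x
    rw [RCLike.inner_apply']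
    simp [mul_comm]
  rw [h1, h2, integral_complex_ofReal, integral_complex_ofReal]
  simp only [Complex.add_re, Complex.ofReal_re, Complex.mul_re, Complex.ofReal_im, mul_zero,
    sub_zero]

end Spectral

/-! ### Conditioning on a trivial σ-algebra; independence gives splitting -/

section TrivialCond

variable {Ω : Type*} {m' m₁ m₂ mΩ : MeasurableSpace Ω} {μ : Measure Ω}

/-- Conditional expectation given a `μ`-trivial σ-algebra is the constant `∫ f dμ`. [folklore] -/
theorem condExp_ae_eq_const_of_forall_measure (hm : m' ≤ mΩ) [IsProbabilityMeasure μ]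
    (htriv : ∀ s, MeasurableSet[m'] s → μ s = 0 ∨ μ s = 1) {f : Ω → ℝ} (hf : Integrable f μ) :
    μ[f | m'] =ᵐ[μ] fun _ => ∫ ω, f ω ∂μ := by
  haveI : IsFiniteMeasure (μ.trim hm) := isFiniteMeasure_trim hm
  refine (ae_eq_condExp_of_forall_setIntegral_eq hm hf (fun s _ _ => integrableOn_const)
    (fun s hs _ => ?_) stronglyMeasurable_const.aestronglyMeasurable).symm
  rcases htriv s hs with h0 | h1
  · have : μ.restrict s = 0 := Measure.restrict_eq_zero.2 h0
    simp [this]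
  · have hae : ∀ᵐ x ∂μ, x ∈ s :=
      mem_ae_iff.2 ((prob_compl_eq_zero_iff (hm s hs)).2 h1)
    rw [Measure.restrict_eq_self_of_ae_mem hae]
    simp [integral_const]

/-- If `m' ≤ m₁`, `m' ≤ m₂` and `m₁`, `m₂` are independent, then `m'` is `μ`-trivial. [folklore] -/
theorem measure_eq_zero_or_one_of_indep_of_le [IsProbabilityMeasure μ] (hind : Indep m₁ m₂ μ)
    (h₁ : m' ≤ m₁) (h₂ : m' ≤ m₂) {s : Set Ω} (hs : MeasurableSet[m'] s) : μ s = 0 ∨ μ s = 1 := by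
  have h := (Indep_iff m₁ m₂ μ).1 hind s s (h₁ s hs) (h₂ s hs)
  rw [Set.inter_self] at h
  by_cases h0 : μ s = 0
  · exact Or.inl h0
  · right
    have hfin : μ s ≠ ∞ := measure_ne_top μ s
    have h' : μ s * 1 = μ s * μ s := by rwa [mul_one]
    exact ((ENNReal.mul_right_inj h0 hfin).1 h').symm

/-- **Independent σ-algebras split over any common sub-σ-algebra**: if `m₁ ⫫ m₂` and
`m' ≤ m₁`, `m' ≤ m₂`, then `m'` is trivial and `μ⟦s ∩ t | m'⟧ = μ⟦s | m'⟧ μ⟦t | m'⟧` a.e. for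
`s ∈ m₁`, `t ∈ m₂` (both sides are the constants `μ(s ∩ t) = μ(s) μ(t)`). [folklore] -/
theorem condIndepCondExp_of_indep_of_le [IsProbabilityMeasure μ] (hind : Indep m₁ m₂ μ)
    (h₁ : m' ≤ m₁) (h₂ : m' ≤ m₂) (hm₁ : m₁ ≤ mΩ) (hm₂ : m₂ ≤ mΩ) :
    CondIndepCondExp m' m₁ m₂ μ := by
  intro s t hs ht
  have hm' : m' ≤ mΩ := h₁.trans hm₁
  have htriv : ∀ u, MeasurableSet[m'] u → μ u = 0 ∨ μ u = 1 := fun u hu =>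
    measure_eq_zero_or_one_of_indep_of_le hind h₁ h₂ hu
  have hs' : MeasurableSet s := hm₁ s hs
  have ht' : MeasurableSet t := hm₂ t ht
  have hint : ∀ {u : Set Ω}, MeasurableSet u → Integrable (u.indicator fun _ => (1 : ℝ)) μ :=
    fun hu => (integrable_const (1 : ℝ)).indicator hu
  have e1 := condExp_ae_eq_const_of_forall_measure hm' htriv (hint (hs'.inter ht'))
  have e2 := condExp_ae_eq_const_of_forall_measure hm' htriv (hint hs')
  have e3 := condExp_ae_eq_const_of_forall_measure hm' htriv (hint ht')
  have hmeas : μ.real (s ∩ t) = μ.real s * μ.real t := by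
    have h := (Indep_iff m₁ m₂ μ).1 hind s t hs ht
    simp only [Measure.real, h, ENNReal.toReal_mul]
  have hI : ∀ {u : Set Ω}, MeasurableSet u → ∫ ω, u.indicator (fun _ => (1 : ℝ)) ω ∂μ = μ.real u :=
    fun hu => by rw [integral_indicator hu, setIntegral_const, smul_eq_mul, mul_one]
  filter_upwards [e1, e2, e3] with ω h1' h2' h3'
  rw [h1', Pi.mul_apply, h2', h3', hI (hs'.inter ht'), hI hs', hI ht', hmeas]

end TrivialCond

/-! ### `L²` functions vanishing a.e. on a set form a closed subspace -/

section Vanishing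

variable {α : Type*} [MeasurableSpace α] {ν : Measure α}

variable (ν) in
/-- The subspace of `L²(ν)` of (classes of) functions vanishing a.e. on the set `S`. [folklore] -/
def vanishingOnSet (S : Set α) : Submodule ℝ (Lp ℝ 2 ν) where
  carrier := {f | ∀ᵐ x ∂ν, x ∈ S → (f : α → ℝ) x = 0}
  zero_mem' := by
    filter_upwards [Lp.coeFn_zero ℝ 2 ν] with x hx _
    rw [hx, Pi.zero_apply]
  add_mem' := by
    intro f g hf hg
    filter_upwards [hf, hg, Lp.coeFn_add f g] with x h1 h2 h3 hx
    rw [h3, Pi.add_apply, h1 hx, h2 hx, add_zero]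
  smul_mem' := by
    intro c f hf
    filter_upwards [hf, Lp.coeFn_smul c f] with x h1 h2 hx
    rw [h2, Pi.smul_apply, h1 hx, smul_zero]

/-- Membership in `vanishingOnSet`. [folklore] -/
theorem mem_vanishingOnSet_iff {S : Set α} {f : Lp ℝ 2 ν} :
    f ∈ vanishingOnSet ν S ↔ ∀ᵐ x ∂ν, x ∈ S → (f : α → ℝ) x = 0 := Iff.rfl

/-- `vanishingOnSet S` is closed in `L²` (an `L²`-limit has an a.e.-convergent subsequence).
[folklore] -/
theorem isClosed_vanishingOnSet (S : Set α) : IsClosed (vanishingOnSet ν S : Set (Lp ℝ 2 ν)) := by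
  refine isSeqClosed_iff_isClosed.1 fun f g hf hfg => ?_
  have h1 : Tendsto (fun n => eLpNorm ((f n : α → ℝ) - (g : α → ℝ)) 2 ν) atTop (𝓝 0) :=
    (Lp.tendsto_Lp_iff_tendsto_eLpNorm' _ _).1 hfg
  have h2 : TendstoInMeasure ν (fun n => (f n : α → ℝ)) atTop (g : α → ℝ) :=
    tendstoInMeasure_of_tendsto_eLpNorm (by norm_num) (fun n => Lp.aestronglyMeasurable _)
      (Lp.aestronglyMeasurable g) h1
  obtain ⟨ns, -, hlim⟩ := h2.exists_seq_tendsto_ae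
  have hall : ∀ᵐ x ∂ν, ∀ n, x ∈ S → (f n : α → ℝ) x = 0 := ae_all_iff.2 fun n => hf n
  show ∀ᵐ x ∂ν, x ∈ S → (g : α → ℝ) x = 0
  filter_upwards [hall, hlim] with x hx hl hxS
  have h0 : Tendsto (fun i => (f (ns i) : α → ℝ) x) atTop (𝓝 0) := by
    simp only [hx _ hxS]
    exact tendsto_const_nhds
  exact tendsto_nhds_unique hl h0

/-- The inner product of two `L²` functions vanishes when one vanishes a.e. on `S`, the other
a.e. on `T`, and `S ∪ T` has full measure. [folklore] -/
theorem inner_eq_zero_of_vanishingOnSet {S T : Set α} {f g : Lp ℝ 2 ν} (hf : f ∈ vanishingOnSet ν S)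
    (hg : g ∈ vanishingOnSet ν T) (hST : ∀ᵐ x ∂ν, x ∈ S ∪ T) :
    @inner ℝ _ _ f g = 0 := by
  rw [MeasureTheory.L2.inner_def]
  refine integral_eq_zero_of_ae ?_
  filter_upwards [hf, hg, hST] with x h1 h2 h3
  rcases h3 with h | h
  · simp [h1 h]
  · simp [h2 h]

end Vanishing

section GermIndep

variable {Ω : Type*} {m₀ : MeasurableSpace Ω} {μ : Measure Ω}

/-! ### The constant `1 ∈ L²(μ; ℂ)` -/

variable (μ) in
/-- The constant function `1` as an element of `L²(μ; ℂ)` (finite measure). [folklore] -/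
def constOneL2 [IsFiniteMeasure μ] : Lp ℂ 2 μ :=
  indicatorConstLp 2 MeasurableSet.univ (measure_ne_top μ _) (1 : ℂ)

/-- `constOneL2 = 1` almost everywhere. [folklore] -/
theorem coeFn_constOneL2 [IsFiniteMeasure μ] : (constOneL2 μ : Ω → ℂ) =ᵐ[μ] fun _ => 1 := by
  unfold constOneL2
  filter_upwards [indicatorConstLp_coeFn (p := 2) (hs := MeasurableSet.univ)
    (hμs := measure_ne_top μ _) (c := (1 : ℂ))] with ω hω
  rw [hω, Set.indicator_of_mem (Set.mem_univ _)]

/-- `⟪1, F⟫ = ∫ F`. [folklore] -/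
theorem inner_constOneL2_left [IsFiniteMeasure μ] (F : Lp ℂ 2 μ) : ⟪constOneL2 μ, F⟫_ℂ = ∫ ω, F ω ∂μ := by
  simp only [constOneL2, MeasureTheory.L2.inner_indicatorConstLp_one, Measure.restrict_univ]

/-- `⟪F, 1⟫ = conj ∫ F`. [folklore] -/
theorem inner_constOneL2_right [IsFiniteMeasure μ] (F : Lp ℂ 2 μ) :
    ⟪F, constOneL2 μ⟫_ℂ = conj (∫ ω, F ω ∂μ) := by
  rw [← inner_conj_symm, inner_constOneL2_left]

/-! ### Orthogonal germ spaces give independent germ σ-algebras -/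

section Germ

variable {V : Type*} [AddCommGroup V] [Module ℝ V]
variable {X : V →ₗ[ℝ] Ω → ℝ}

/-- **Base case (characters).**  For a centred Gaussian linear process and `x ⊥ y` in the Gaussian
space, `E[e^{-ix} e^{iy}] = E[e^{-ix}] E[e^{iy}]` (orthogonal jointly Gaussian variables are
independent), written with the `L²(ℂ)` inner product: `⟪e^{ix}, e^{iy}⟫ = ⟪e^{ix}, 1⟫ ⟪1, e^{iy}⟫`.
[cite: Rozanov1982, Ch. 2 §3.1] -/
theorem inner_expI_expI_eq_of_inner_eq_zero [IsFiniteMeasure μ] (h : IsGaussianLinearProcess X μ)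
    {x y : Lp ℝ 2 μ} (hx : x ∈ h.space ⊤) (hy : y ∈ h.space ⊤) (hxy : ⟪x, y⟫_ℝ = 0) :
    ⟪h.expI (Lp.aestronglyMeasurable x), h.expI (Lp.aestronglyMeasurable y)⟫_ℂ =
      ⟪h.expI (Lp.aestronglyMeasurable x), constOneL2 μ⟫_ℂ *
        ⟪constOneL2 μ, h.expI (Lp.aestronglyMeasurable y)⟫_ℂ := by
  have hind := h.indepFun_of_inner_eq_zero hx hy hxy
  have hme : Measurable fun t : ℝ => cexp (t * I) :=
    Complex.measurable_exp.comp (Complex.measurable_ofReal.mul_const I)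
  have hind' : IndepFun (fun ω => conj (cexp (((x : Ω → ℝ) ω : ℂ) * I)))
      (fun ω => cexp (((y : Ω → ℝ) ω : ℂ) * I)) μ :=
    hind.comp (Complex.continuous_conj.measurable.comp hme) hme
  have hprod := hind'.integral_fun_mul_eq_mul_integral (by fun_prop) (by fun_prop)
  have hA : ⟪h.expI (Lp.aestronglyMeasurable x), h.expI (Lp.aestronglyMeasurable y)⟫_ℂ =
      ∫ ω, conj (cexp (((x : Ω → ℝ) ω : ℂ) * I)) * cexp (((y : Ω → ℝ) ω : ℂ) * I) ∂μ := by
    rw [h.inner_expI]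
    refine integral_congr_ae ?_
    filter_upwards [h.coeFn_expI (Lp.aestronglyMeasurable x)] with ω hω
    rw [hω]
  have hB : ⟪h.expI (Lp.aestronglyMeasurable x), constOneL2 μ⟫_ℂ =
      ∫ ω, conj (cexp (((x : Ω → ℝ) ω : ℂ) * I)) ∂μ := by
    rw [inner_constOneL2_right, ← integral_conj]
    refine integral_congr_ae ?_
    filter_upwards [h.coeFn_expI (Lp.aestronglyMeasurable x)] with ω hω
    rw [hω]
  have hC : ⟪constOneL2 μ, h.expI (Lp.aestronglyMeasurable y)⟫_ℂ =
      ∫ ω, cexp (((y : Ω → ℝ) ω : ℂ) * I) ∂μ := by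
    rw [inner_constOneL2_left]
    exact integral_congr_ae (h.coeFn_expI (Lp.aestronglyMeasurable y))
  rw [hA, hB, hC, hprod]

/-- **Factorisation on the germ characters.**  If the germ spaces `H₊(S₁) ⊥ H₊(S₂)` are orthogonal,
then `⟪F, G⟫ = ⟪F, 1⟫ ⟪1, G⟫` for all `F ∈ germExpSpan S₁`, `G ∈ germExpSpan S₂` (from the
characters by sesquilinearity and continuity). [cite: Rozanov1982, Ch. 2 §3.1] -/
theorem inner_eq_of_mem_germExpSpan [IsFiniteMeasure μ] (h : IsGaussianLinearProcess X μ)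
    (S₁ S₂ : ℕ → Submodule ℝ V)
    (horth : ∀ x ∈ h.germSpace S₁, ∀ y ∈ h.germSpace S₂, ⟪x, y⟫_ℝ = 0)
    {F G : Lp ℂ 2 μ} (hF : F ∈ h.germExpSpan S₁) (hG : G ∈ h.germExpSpan S₂) :
    ⟪F, G⟫_ℂ = ⟪F, constOneL2 μ⟫_ℂ * ⟪constOneL2 μ, G⟫_ℂ := by
  have htop₁ : h.germSpace S₁ ≤ h.space ⊤ := (h.germSpace_le S₁ 0).trans (h.space_mono le_top)
  have htop₂ : h.germSpace S₂ ≤ h.space ⊤ := (h.germSpace_le S₂ 0).trans (h.space_mono le_top)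
  -- the set of `G'` with `⟪F', G'⟫ = ⟪F', 1⟫ ⟪1, G'⟫` is a closed submodule (a kernel)
  have hker : ∀ F' : Lp ℂ 2 μ, ∀ G' : Lp ℂ 2 μ,
      G' ∈ LinearMap.ker ((innerSL ℂ F' - ⟪F', constOneL2 μ⟫_ℂ • innerSL ℂ (constOneL2 μ) :
        Lp ℂ 2 μ →L[ℂ] ℂ) : Lp ℂ 2 μ →ₗ[ℂ] ℂ) ↔ ⟪F', G'⟫_ℂ = ⟪F', constOneL2 μ⟫_ℂ * ⟪constOneL2 μ, G'⟫_ℂ := by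
    intro F' G'
    rw [LinearMap.mem_ker, ContinuousLinearMap.coe_coe, FunLike.coe_sub, Pi.sub_apply,
      FunLike.coe_smul, Pi.smul_apply, innerSL_apply_apply, innerSL_apply_apply,
      smul_eq_mul, sub_eq_zero]
  -- step 1: `F` ranges over `germExpSpan S₁`, `G = e^{iy}` a character of `H₊(S₂)`
  have hstep1 : ∀ y ∈ h.germSpace S₂, ∀ F' ∈ h.germExpSpan S₁,
      ⟪F', h.expI (Lp.aestronglyMeasurable y)⟫_ℂ =
        ⟪F', constOneL2 μ⟫_ℂ * ⟪constOneL2 μ, h.expI (Lp.aestronglyMeasurable y)⟫_ℂ := by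
    intro y hy F' hF'
    set Gy := h.expI (Lp.aestronglyMeasurable y) with hGy
    -- use the conjugate-symmetric kernel: `F' ↦ ⟪Gy, F'⟫ - ⟪Gy, 1⟫ ⟪1, F'⟫`
    let T : Lp ℂ 2 μ →L[ℂ] ℂ := innerSL ℂ Gy - ⟪Gy, constOneL2 μ⟫_ℂ • innerSL ℂ (constOneL2 μ)
    have hle : Submodule.span ℂ (Set.range fun z : h.germSpace S₁ =>
        h.expI (Lp.aestronglyMeasurable (z : Lp ℝ 2 μ))) ≤
        LinearMap.ker (T : Lp ℂ 2 μ →ₗ[ℂ] ℂ) := by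
      refine Submodule.span_le.2 ?_
      rintro _ ⟨z, rfl⟩
      rw [SetLike.mem_coe, hker]
      -- `⟪Gy, e^{iz}⟫ = ⟪Gy, 1⟫ ⟪1, e^{iz}⟫` from the base case for `(z, y)` by conjugation
      have hb := inner_expI_expI_eq_of_inner_eq_zero h (htop₁ z.2) (htop₂ hy) (horth _ z.2 _ hy)
      rw [← inner_conj_symm, hb, map_mul, inner_conj_symm, inner_conj_symm, mul_comm]
    have hmem : F' ∈ LinearMap.ker (T : Lp ℂ 2 μ →ₗ[ℂ] ℂ) :=
      Submodule.topologicalClosure_minimal _ hle T.isClosed_ker hF'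
    rw [hker] at hmem
    -- conjugate back
    rw [← inner_conj_symm, hmem, map_mul, inner_conj_symm, inner_conj_symm, mul_comm]
  -- step 2: fix `F ∈ germExpSpan S₁` and let `G` range over `germExpSpan S₂`
  let T : Lp ℂ 2 μ →L[ℂ] ℂ := innerSL ℂ F - ⟪F, constOneL2 μ⟫_ℂ • innerSL ℂ (constOneL2 μ)
  have hle : Submodule.span ℂ (Set.range fun z : h.germSpace S₂ =>
      h.expI (Lp.aestronglyMeasurable (z : Lp ℝ 2 μ))) ≤ LinearMap.ker (T : Lp ℂ 2 μ →ₗ[ℂ] ℂ) := by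
    refine Submodule.span_le.2 ?_
    rintro _ ⟨z, rfl⟩
    rw [SetLike.mem_coe, hker]
    exact hstep1 _ z.2 F hF
  have hmem : G ∈ LinearMap.ker (T : Lp ℂ 2 μ →ₗ[ℂ] ℂ) :=
    Submodule.topologicalClosure_minimal _ hle T.isClosed_ker hG
  exact (hker F G).1 hmem

/-- **Orthogonal germ spaces have independent germ σ-algebras.**  For a centred Gaussian linear
process and antitone sequences `S₁`, `S₂` of submodules of test vectors with `H₊(S₁) ⊥ H₊(S₂)`,
the germ σ-algebras `⨅ n, σ(X_{S₁ n})` and `⨅ n, σ(X_{S₂ n})` are independent: indicators of germ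
events lie in the closed spans of the germ characters (`indicatorConstLp_mem_germExpSpan`), on
which `E[F G] = E[F] E[G]` (`inner_eq_of_mem_germExpSpan`).  This is the Gaussian dictionary
"independence of `𝒜₊(S₁)`, `𝒜₊(S₂)` ⟺ orthogonality of `H₊(S₁)`, `H₊(S₂)`" of Rozanov 1982,
Ch. 2 §3.1/§3.3. [cite: Rozanov1982, Ch. 2 §3.1 and §3.3] -/
theorem indep_iInf_sigma_of_germSpace_orthogonal (h : IsGaussianLinearProcess X μ)
    {S₁ S₂ : ℕ → Submodule ℝ V} (hS₁ : Antitone S₁) (hS₂ : Antitone S₂)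
    (horth : ∀ x ∈ h.germSpace S₁, ∀ y ∈ h.germSpace S₂, ⟪x, y⟫_ℝ = 0) :
    Indep (⨅ n, IsGaussianLinearProcess.sigma (X := X) (S₁ n))
      (⨅ n, IsGaussianLinearProcess.sigma (X := X) (S₂ n)) μ := by
  haveI := h.isProbabilityMeasure
  have hle₁ : (⨅ n, IsGaussianLinearProcess.sigma (X := X) (S₁ n)) ≤ m₀ :=
    (iInf_le _ 0).trans (IsGaussianLinearProcess.sigma_le h.measurable (S₁ 0))
  have hle₂ : (⨅ n, IsGaussianLinearProcess.sigma (X := X) (S₂ n)) ≤ m₀ :=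
    (iInf_le _ 0).trans (IsGaussianLinearProcess.sigma_le h.measurable (S₂ 0))
  rw [Indep_iff]
  intro A B hA hB
  have hAm : MeasurableSet A := hle₁ A hA
  have hBm : MeasurableSet B := hle₂ B hB
  have hA1 := h.indicatorConstLp_mem_germExpSpan S₁ hS₁ hA hAm (measure_ne_top μ A)
  have hB1 := h.indicatorConstLp_mem_germExpSpan S₂ hS₂ hB hBm (measure_ne_top μ B)
  have hfac := inner_eq_of_mem_germExpSpan h S₁ S₂ horth hA1 hB1
  -- evaluate the three inner products
  rw [MeasureTheory.L2.inner_indicatorConstLp_one, inner_constOneL2_left, inner_constOneL2_right,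
    setIntegral_indicatorConstLp hAm, integral_indicatorConstLp, integral_indicatorConstLp] at hfac
  simp only [Complex.real_smul, mul_one, Complex.conj_ofReal] at hfac
  have hreal : μ.real (B ∩ A) = μ.real A * μ.real B := by exact_mod_cast hfac
  rw [Set.inter_comm] at hreal
  rw [← ENNReal.toReal_eq_toReal_iff' (measure_ne_top μ _)
    (ENNReal.mul_ne_top (measure_ne_top μ A) (measure_ne_top μ B)), ENNReal.toReal_mul]
  exact hreal

end Germ

end GermIndep

/-! ### The evaluation process of a law on field configurations -/

section Eval

variable {E : Type*} [NormedAddCommGroup E] [NormedSpace ℝ E]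

/-- The evaluation process `f ↦ (ω ↦ ω f)` of field configurations, as a linear map (Rozanov's
generalized random function `(u, ξ)`, Ch. 2 §3.1). [folklore] -/
def evalProcess : 𝓢(E, ℝ) →ₗ[ℝ] FieldConfig E → ℝ where
  toFun f ω := ω f
  map_add' f g := by funext ω; exact map_add ω f g
  map_smul' c f := by funext ω; exact map_smul ω c f

/-- Unfolding lemma for `evalProcess`. [folklore] -/
@[simp] theorem evalProcess_apply (f : 𝓢(E, ℝ)) (ω : FieldConfig E) : evalProcess f ω = ω f := rfl

/-- Under a centred Gaussian law on `𝒮'`, the evaluation process is a centred Gaussian linear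
process (finite-dimensional marginals are images of `μ` under continuous linear maps).
[folklore] -/
theorem isGaussianLinearProcess_evalProcess {μ : Measure (FieldConfig E)} (hG : IsGaussianField μ) :
    IsGaussianLinearProcess (evalProcess (E := E)) μ where
  measurable f := measurable_eval f
  centered f := (hG.2 f).2
  isGaussianProcess := by
    haveI := hG.1
    refine ⟨fun I => ?_⟩
    let L : FieldConfig E →L[ℝ] (I → ℝ) :=
      ContinuousLinearMap.pi fun f : I =>
        PointwiseConvergenceCLM.evalCLM (RingHom.id ℝ) ℝ (f : 𝓢(E, ℝ))
    have hLm : Measurable L := L.continuous.measurable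
    haveI : IsGaussian (μ.map L) := isGaussian_map_of_measurable hLm
    have h2 : (fun ω => I.restrict fun f => evalProcess f ω) = ⇑L := by
      funext ω
      rfl
    rw [h2]
    exact IsGaussian.hasGaussianLaw

/-- Test functions supported in `U`, as a submodule. [folklore] -/
def realSupportedIn (U : Set E) : Submodule ℝ 𝓢(E, ℝ) where
  carrier := {f | tsupport (f : E → ℝ) ⊆ U}
  zero_mem' := by
    show tsupport ((0 : 𝓢(E, ℝ)) : E → ℝ) ⊆ U
    rw [FunLike.coe_zero, tsupport, Function.support_zero, closure_empty]
    exact Set.empty_subset U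
  add_mem' := by
    intro f g hf hg
    change tsupport ((f : E → ℝ) + (g : E → ℝ)) ⊆ U
    exact (tsupport_add (f : E → ℝ) (g : E → ℝ)).trans (Set.union_subset hf hg)
  smul_mem' := by
    intro c f hf
    change tsupport (fun x => c • (f : E → ℝ) x) ⊆ U
    exact (tsupport_smul_subset_right (fun _ : E => c) (f : E → ℝ)).trans hf

/-- Membership in `realSupportedIn`. [folklore] -/
theorem mem_realSupportedIn_iff {U : Set E} {f : 𝓢(E, ℝ)} : f ∈ realSupportedIn U ↔ tsupport (f : E → ℝ) ⊆ U :=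
  Iff.rfl

/-- `realSupportedIn` is monotone in the region. [folklore] -/
theorem realSupportedIn_mono {U V : Set E} (h : U ⊆ V) : realSupportedIn U ≤ realSupportedIn V := fun _ hf => hf.trans h

/-- The region σ-algebra `𝒜(U)` is contained in `σ(ω(f) : f ∈ realSupportedIn U)`. [folklore] -/
theorem fieldSigma_le_sigma_realSupportedIn (U : Set E) :
    fieldSigma U ≤ IsGaussianLinearProcess.sigma (X := evalProcess (E := E)) (realSupportedIn U) :=
  iSup_le fun f => le_iSup_of_le ⟨f.1, f.2⟩ le_rfl

/-- The antitone sequence of submodules of test functions supported in `A^{1/(n+1)}`. [folklore] -/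
def thickeningSeq (A : Set E) (n : ℕ) : Submodule ℝ 𝓢(E, ℝ) :=
  realSupportedIn (Metric.thickening (1 / ((n : ℝ) + 1)) A)

/-- `thickeningSeq A` is antitone (the neighbourhoods shrink). [folklore] -/
theorem thickeningSeq_antitone (A : Set E) : Antitone (thickeningSeq A) := by
  intro m n hmn
  refine realSupportedIn_mono (Metric.thickening_mono ?_ A)
  have hm : (0 : ℝ) < (m : ℝ) + 1 := by positivity
  exact one_div_le_one_div_of_le hm (by exact_mod_cast Nat.add_le_add_right hmn 1)

/-- The germ σ-algebra `𝒜₊(A)` is contained in `⨅ n, σ(ω(f) : supp f ⊆ A^{1/(n+1)})`. [folklore] -/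
theorem germSigma_le_iInf_sigma_thickeningSeq (A : Set E) :
    germSigma A ≤ ⨅ n, IsGaussianLinearProcess.sigma (X := evalProcess (E := E)) (thickeningSeq A n) :=
  le_iInf fun n => (germSigma_le_fieldSigma_thickening A (by positivity)).trans
    (fieldSigma_le_sigma_realSupportedIn _)

end Eval

/-! ### The `H¹` model of the counterexample field (`d = 1`) -/

section H1

open scoped LineDeriv

/-- `L²(ℝ¹)` (Lebesgue measure). [folklore] -/
private abbrev L2v : Type := Lp ℝ 2 (volume : Measure E1')

/-- The Hilbert sum `L²(ℝ¹) ⊕ L²(ℝ¹)`. [folklore] -/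
private abbrev F2 : Type := WithLp 2 (L2v × L2v)

/-- The model vector `(u, (2π)⁻¹ ∂u) ∈ L² ⊕ L²` of a test function. [folklore] -/
def h1ModelVec (u : 𝓢(E1', ℝ)) : F2 :=
  WithLp.toLp 2 (u.toLp 2 (volume : Measure E1'),
    (2 * Real.pi)⁻¹ • (∂_{e0'} u : 𝓢(E1', ℝ)).toLp 2 (volume : Measure E1'))

/-- `⟪(u, u'/2π), (v, v'/2π)⟫ = ∫ u v + (4π²)⁻¹ ∫ u' v'`. [folklore] -/
theorem inner_h1ModelVec (u v : 𝓢(E1', ℝ)) :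
    ⟪h1ModelVec u, h1ModelVec v⟫_ℝ = (∫ x, u x * v x) + (4 * Real.pi ^ 2)⁻¹ *
      ∫ x, (∂_{e0'} u : 𝓢(E1', ℝ)) x * (∂_{e0'} v : 𝓢(E1', ℝ)) x := by
  rw [h1ModelVec, h1ModelVec, WithLp.prod_inner_apply]
  rw [real_inner_smul_left, real_inner_smul_right, inner_toLp_schwartz, inner_toLp_schwartz]
  have hpi : (2 * Real.pi)⁻¹ * ((2 * Real.pi)⁻¹ *
      ∫ x, (∂_{e0'} u : 𝓢(E1', ℝ)) x * (∂_{e0'} v : 𝓢(E1', ℝ)) x) =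
      (4 * Real.pi ^ 2)⁻¹ * ∫ x, (∂_{e0'} u : 𝓢(E1', ℝ)) x * (∂_{e0'} v : 𝓢(E1', ℝ)) x := by
    rw [← mul_assoc, ← mul_inv]
    congr 2
    ring
  rw [hpi]

/-- The first component of the model vector of `u` vanishes off `tsupport u`. [folklore] -/
theorem h1ModelVec_fst_mem {U : Set E1'} {u : 𝓢(E1', ℝ)} (hu : tsupport (u : E1' → ℝ) ⊆ U) :
    (h1ModelVec u).fst ∈ vanishingOnSet volume Uᶜ := by
  rw [mem_vanishingOnSet_iff]
  simp only [h1ModelVec, WithLp.toLp_fst]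
  filter_upwards [SchwartzMap.coeFn_toLp u 2 (volume : Measure E1')] with x hx hxU
  rw [hx]
  exact image_eq_zero_of_notMem_tsupport fun h => hxU (hu h)

/-- The second component of the model vector of `u` vanishes off `tsupport u`. [folklore] -/
theorem h1ModelVec_snd_mem {U : Set E1'} {u : 𝓢(E1', ℝ)} (hu : tsupport (u : E1' → ℝ) ⊆ U) :
    (h1ModelVec u).snd ∈ vanishingOnSet volume Uᶜ := by
  simp only [h1ModelVec, WithLp.toLp_snd]
  refine Submodule.smul_mem _ _ ?_
  rw [mem_vanishingOnSet_iff]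
  filter_upwards [SchwartzMap.coeFn_toLp (∂_{e0'} u : 𝓢(E1', ℝ)) 2 (volume : Measure E1')]
    with x hx hxU
  rw [hx, SchwartzMap.lineDerivOp_apply_eq_fderiv]
  have h0 : fderiv ℝ (u : E1' → ℝ) x = 0 := by
    by_contra hne
    exact hxU (hu (support_fderiv_subset ℝ (Function.mem_support.2 hne)))
  rw [h0]
  rfl

/-- Pairs of `L²` functions both vanishing a.e. on `S`. [folklore] -/
def vanishingOnSet₂ (S : Set E1') : Submodule ℝ F2 where
  carrier := {p | p.fst ∈ vanishingOnSet volume S ∧ p.snd ∈ vanishingOnSet volume S}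
  zero_mem' := ⟨(vanishingOnSet volume S).zero_mem, (vanishingOnSet volume S).zero_mem⟩
  add_mem' := fun hp hq => ⟨add_mem hp.1 hq.1, add_mem hp.2 hq.2⟩
  smul_mem' := fun c _ hp => ⟨Submodule.smul_mem _ c hp.1, Submodule.smul_mem _ c hp.2⟩

/-- `vanishingOnSet₂ S` is closed. [folklore] -/
theorem isClosed_vanishingOnSet₂ (S : Set E1') : IsClosed (vanishingOnSet₂ S : Set F2) :=
  ((isClosed_vanishingOnSet S).preimage (WithLp.continuous_fst (p := 2) (α := L2v) (β := L2v))).inter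
    ((isClosed_vanishingOnSet S).preimage (WithLp.continuous_snd (p := 2) (α := L2v) (β := L2v)))

variable {μ : Measure (FieldConfig E1')}

/-- The Gram identity: `E[ω(u) ω(v)] = ⟪h1ModelVec u, h1ModelVec v⟫`. [folklore] -/
theorem inner_toL2_eq_inner_h1ModelVec (hX : IsGaussianLinearProcess (evalProcess (E := E1')) μ)
    (h2 : ∀ u v : 𝓢(E1', ℝ), twoPoint μ u v = (∫ x, u x * v x) + (4 * Real.pi ^ 2)⁻¹ *
      ∫ x, (∂_{e0'} u : 𝓢(E1', ℝ)) x * (∂_{e0'} v : 𝓢(E1', ℝ)) x)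
    (u v : 𝓢(E1', ℝ)) : ⟪hX.toL2 u, hX.toL2 v⟫_ℝ = ⟪h1ModelVec u, h1ModelVec v⟫_ℝ := by
  rw [hX.inner_toL2, inner_h1ModelVec, ← h2]
  rfl

/-- **The `H¹` model**: a bounded linear map `T : L²(μ) → L² ⊕ L²` with `T(ω(u)) = (u, (2π)⁻¹∂u)`
which is isometric on the Gaussian space (the "lurking isometry" of the Gram identity). [folklore] -/
theorem exists_h1Model (hX : IsGaussianLinearProcess (evalProcess (E := E1')) μ)
    (h2 : ∀ u v : 𝓢(E1', ℝ), twoPoint μ u v = (∫ x, u x * v x) + (4 * Real.pi ^ 2)⁻¹ *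
      ∫ x, (∂_{e0'} u : 𝓢(E1', ℝ)) x * (∂_{e0'} v : 𝓢(E1', ℝ)) x) :
    ∃ T : Lp ℝ 2 μ →L[ℝ] F2, (∀ u, T (hX.toL2 u) = h1ModelVec u) ∧
      ∀ v ∈ hX.space ⊤, ∀ w ∈ hX.space ⊤, ⟪T v, T w⟫_ℝ = ⟪v, w⟫_ℝ := by
  haveI := hX.isProbabilityMeasure
  obtain ⟨T, hT, hiso, hproj⟩ := Literature.Analysis.InnerProduct.exists_clm_of_gram_eq (𝕜 := ℝ)
    (fun u => hX.toL2 u) h1ModelVec (fun u v => inner_toL2_eq_inner_h1ModelVec hX h2 u v)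
  have hM : (Submodule.span ℝ (Set.range fun u => hX.toL2 u)).topologicalClosure = hX.space ⊤ := by
    change _ = ((⊤ : Submodule ℝ 𝓢(E1', ℝ)).map hX.toL2).topologicalClosure
    rw [Submodule.map_top]
    congr 1
    change Submodule.span ℝ (Set.range hX.toL2) = _
    rw [← LinearMap.coe_range, Submodule.span_eq]
  refine ⟨T, hT, fun v hv w hw => ?_⟩
  obtain ⟨-, -, hinner⟩ := Literature.Analysis.InnerProduct.norm_and_inner_of_gram hiso hproj
  have hv' : v ∈ (Submodule.span ℝ (Set.range fun u => hX.toL2 u)).topologicalClosure := by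
    rw [hM]; exact hv
  have hw' : w ∈ (Submodule.span ℝ (Set.range fun u => hX.toL2 u)).topologicalClosure := by
    rw [hM]; exact hw
  rw [hinner, Submodule.starProjection_eq_self_iff.2 hv', Submodule.starProjection_eq_self_iff.2 hw']

variable (hX : IsGaussianLinearProcess (evalProcess (E := E1')) μ)
include hX

/-- `T` maps `H(realSupportedIn U)` into pairs vanishing a.e. off `U`. [folklore] -/
theorem space_realSupportedIn_le_comap {T : Lp ℝ 2 μ →L[ℝ] F2} (hT : ∀ u, T (hX.toL2 u) = h1ModelVec u)
    (U : Set E1') :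
    hX.space (realSupportedIn U) ≤ (vanishingOnSet₂ Uᶜ).comap (T : Lp ℝ 2 μ →ₗ[ℝ] F2) := by
  change ((realSupportedIn U).map hX.toL2).topologicalClosure ≤ _
  refine Submodule.topologicalClosure_minimal _ ?_
    ((isClosed_vanishingOnSet₂ Uᶜ).preimage T.continuous)
  rintro _ ⟨u, hu, rfl⟩
  show T (hX.toL2 u) ∈ vanishingOnSet₂ Uᶜ
  rw [hT]
  exact ⟨h1ModelVec_fst_mem hu, h1ModelVec_snd_mem hu⟩

/-- Elements of the germ space `H₊(A)` are modelled by pairs vanishing a.e. off `closure A`.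
[folklore] -/
theorem h1Model_germSpace_vanishing {T : Lp ℝ 2 μ →L[ℝ] F2} (hT : ∀ u, T (hX.toL2 u) = h1ModelVec u)
    {A : Set E1'} {x : Lp ℝ 2 μ} (hx : x ∈ hX.germSpace (thickeningSeq A)) :
    (T x).fst ∈ vanishingOnSet volume (closure A)ᶜ ∧ (T x).snd ∈ vanishingOnSet volume (closure A)ᶜ := by
  have hn : ∀ n : ℕ, T x ∈ vanishingOnSet₂ (Metric.thickening (1 / ((n : ℝ) + 1)) A)ᶜ := fun n => by
    have hmem := space_realSupportedIn_le_comap hX hT (Metric.thickening (1 / ((n : ℝ) + 1)) A)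
      (hX.germSpace_le (thickeningSeq A) n hx)
    simpa only [Submodule.mem_comap, ContinuousLinearMap.coe_coe] using hmem
  have h1 : ∀ᵐ y ∂(volume : Measure E1'), ∀ n : ℕ,
      y ∈ (Metric.thickening (1 / ((n : ℝ) + 1)) A)ᶜ → ((T x).fst : E1' → ℝ) y = 0 :=
    ae_all_iff.2 fun n => (hn n).1
  have h2 : ∀ᵐ y ∂(volume : Measure E1'), ∀ n : ℕ,
      y ∈ (Metric.thickening (1 / ((n : ℝ) + 1)) A)ᶜ → ((T x).snd : E1' → ℝ) y = 0 :=
    ae_all_iff.2 fun n => (hn n).2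
  have key : ∀ y : E1', y ∈ (closure A)ᶜ → ∃ n : ℕ, y ∈ (Metric.thickening (1 / ((n : ℝ) + 1)) A)ᶜ := by
    intro y hy
    rw [Set.mem_compl_iff, Metric.closure_eq_iInter_thickening] at hy
    simp only [Set.mem_iInter, not_forall] at hy
    obtain ⟨ε, hε, hyε⟩ := hy
    obtain ⟨n, hn⟩ := exists_nat_one_div_lt hε
    exact ⟨n, fun hmem => hyε (Metric.thickening_mono hn.le A hmem)⟩
  constructor
  · rw [mem_vanishingOnSet_iff]
    filter_upwards [h1] with y hy hyA
    obtain ⟨n, hn'⟩ := key y hyA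
    exact hy n hn'
  · rw [mem_vanishingOnSet_iff]
    filter_upwards [h2] with y hy hyA
    obtain ⟨n, hn'⟩ := key y hyA
    exact hy n hn'

/-- **`H₊(B̄) ⊥ H₊(Bᶜ)` for the counterexample field** (`d = 1`, `B` an open ball): in the
`H¹` model the two germ spaces consist of pairs supported in `B̄`, resp. in `Bᶜ`, and
`B̄ ∩ Bᶜ = ∂B` is Lebesgue-null. [folklore] -/
theorem germSpace_orthogonal {T : Lp ℝ 2 μ →L[ℝ] F2} (hT : ∀ u, T (hX.toL2 u) = h1ModelVec u)
    (hTin : ∀ v ∈ hX.space ⊤, ∀ w ∈ hX.space ⊤, ⟪T v, T w⟫_ℝ = ⟪v, w⟫_ℝ) (c : E1') (r : ℝ)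
    {x y : Lp ℝ 2 μ} (hx : x ∈ hX.germSpace (thickeningSeq (Metric.closedBall c r)))
    (hy : y ∈ hX.germSpace (thickeningSeq (Metric.ball c r)ᶜ)) : ⟪x, y⟫_ℝ = 0 := by
  have hx' : x ∈ hX.space ⊤ := (hX.germSpace_le _ 0).trans (hX.space_mono le_top) hx
  have hy' : y ∈ hX.space ⊤ := (hX.germSpace_le _ 0).trans (hX.space_mono le_top) hy
  rw [← hTin x hx' y hy', WithLp.prod_inner_apply]
  obtain ⟨hx1, hx2⟩ := h1Model_germSpace_vanishing hX hT hx
  obtain ⟨hy1, hy2⟩ := h1Model_germSpace_vanishing hX hT hy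
  rw [Metric.isClosed_closedBall.closure_eq] at hx1 hx2
  rw [(Metric.isOpen_ball.isClosed_compl).closure_eq] at hy1 hy2
  have hST : ∀ᵐ z ∂(volume : Measure E1'), z ∈ (Metric.closedBall c r)ᶜ ∪ (Metric.ball c r)ᶜᶜ := by
    have h0 : (volume : Measure E1') (Metric.sphere c r) = 0 := Measure.addHaar_sphere volume c r
    rw [ae_iff]
    refine measure_mono_null (fun z hz => ?_) h0
    simp only [Set.mem_setOf_eq, Set.mem_union, Set.mem_compl_iff, not_or, not_not] at hz
    rw [Metric.mem_sphere]
    exact le_antisymm (Metric.mem_closedBall.1 hz.1)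
      (not_lt.1 fun h => hz.2 (Metric.mem_ball.2 h))
  simp only [WithLp.ofLp_fst, WithLp.ofLp_snd]
  rw [inner_eq_zero_of_vanishingOnSet hx1 hy1 hST, inner_eq_zero_of_vanishingOnSet hx2 hy2 hST,
    add_zero]

end H1

/-! ### (K) at every ball for the counterexample field; the refutation -/

section Refutation

open scoped LineDeriv

/-- **The germ-Markov hypothesis (K) holds at every ball for the counterexample field.**  For a
centred Gaussian law on `𝒮'(ℝ¹)` with covariance `∫ u v + (4π²)⁻¹ ∫ u' v'` (spectral density
`1 + ‖ξ‖²`) and every ball `B = (c - r, c + r)`, the germ σ-algebra `𝒜₊(∂B)` splits `𝒜₊(B̄)` and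
`𝒜₊(Bᶜ)` — indeed `𝒜₊(B̄) ⫫ 𝒜₊(Bᶜ)` (their germ Gaussian spaces are orthogonal in the `H¹` model,
`∂B` being Lebesgue-null) and `𝒜₊(∂B)` is contained in both.  This is the hypothesis (K) of
`InvSpectralDensityPolynomialOfGermMarkov`, although `1/φ = (1 + ‖ξ‖²)⁻¹` is not a polynomial:
the field is NOT Markov in Rozanov's collar sense (R) (Ch. 2 §1.3 (1.26)), for which his spectral
criterion Ch. 3 §2.3 is stated. [cite: Rozanov1982, Ch. 2 §1.3 (1.26)–(1.28), §3.3 (3.10), (3.16)] -/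
theorem condIndepCondExp_germSigma_ball {μ : Measure (FieldConfig E1')} (hG : IsGaussianField μ)
    (h2 : ∀ u v : 𝓢(E1', ℝ), twoPoint μ u v = (∫ x, u x * v x) + (4 * Real.pi ^ 2)⁻¹ *
      ∫ x, (∂_{e0'} u : 𝓢(E1', ℝ)) x * (∂_{e0'} v : 𝓢(E1', ℝ)) x)
    (c : E1') {r : ℝ} (hr : 0 < r) :
    CondIndepCondExp (germSigma (frontier (Metric.ball c r)))
      (germSigma (closure (Metric.ball c r))) (germSigma (Metric.ball c r)ᶜ) μ := by
  have hX := isGaussianLinearProcess_evalProcess hG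
  haveI := hX.isProbabilityMeasure
  obtain ⟨T, hT, hTin⟩ := exists_h1Model hX h2
  have horth : ∀ x ∈ hX.germSpace (thickeningSeq (Metric.closedBall c r)),
      ∀ y ∈ hX.germSpace (thickeningSeq (Metric.ball c r)ᶜ), ⟪x, y⟫_ℝ = 0 :=
    fun x hx y hy => germSpace_orthogonal hX hT hTin c r hx hy
  have hind := indep_iInf_sigma_of_germSpace_orthogonal hX (thickeningSeq_antitone _)
    (thickeningSeq_antitone _) horth
  have hind' : Indep (germSigma (closure (Metric.ball c r))) (germSigma (Metric.ball c r)ᶜ) μ := by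
    refine indep_of_indep_of_le_right (indep_of_indep_of_le_left hind ?_) ?_
    · rw [closure_ball c hr.ne']
      exact germSigma_le_iInf_sigma_thickeningSeq _
    · exact germSigma_le_iInf_sigma_thickeningSeq _
  refine condIndepCondExp_of_indep_of_le hind' (germSigma_mono frontier_subset_closure) ?_
    (germSigma_le _) (germSigma_le _)
  refine germSigma_mono ?_
  rw [← frontier_compl]
  exact frontier_subset_closure.trans (Metric.isOpen_ball.isClosed_compl).closure_eq.subset

-- names the `@[deprecated]` record `InvSpectralDensityPolynomialOfGermMarkov` of
-- `GermMarkovSpectralCriterion.lean` on purpose: this IS its refutation (verdict clean-up 2026-08-17);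
-- REMOVE-WHEN the record is deleted from `GermMarkovSpectralCriterion.lean`
set_option linter.deprecated false in
/-- **`InvSpectralDensityPolynomialOfGermMarkov` is false.**  The law of
`exists_counterexampleLaw_one` (`d = 1`, spectral density `φ(ξ) = 1 + ‖ξ‖²`) satisfies every
hypothesis of the fact — the analytic ones (`counterexampleDensity_hypotheses`), the spectral form
of the covariance (`integral_mul_add_lineDeriv_eq_spectral`) and the germ-Markov property (K) at
every ball (`condIndepCondExp_germSigma_ball`) — while `1/φ` is a.e. equal to no polynomial
(`inv_one_add_norm_sq_ne_eval`).  See the Erratum in `GermMarkovSpectralCriterion.lean`: the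
published theorem (Rozanov 1982, Ch. 3 §2.3) concerns the collar Markov property (R), not (K).
[cite: Rozanov1982, Ch. 3 §2.3 with Ch. 2 §1.3 (1.26)–(1.28)] -/
theorem not_InvSpectralDensityPolynomialOfGermMarkov : ¬ InvSpectralDensityPolynomialOfGermMarkov := by
  intro H
  obtain ⟨μ, hP, hG, h2⟩ := exists_counterexampleLaw_one
  obtain ⟨hmeas, hnn, hpos, heven, hint1, hint2⟩ := counterexampleDensity_hypotheses 1
  obtain ⟨P, hPeq⟩ := H 1 μ (fun ξ => 1 + ‖ξ‖ ^ 2) hP hG hmeas hnn hpos heven hint1 hint2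
    (fun u v => by
      rw [h2 u v]
      exact integral_mul_add_lineDeriv_eq_spectral u v)
    (fun c r hr => condIndepCondExp_germSigma_ball hG h2 c hr)
  exact inv_one_add_norm_sq_ne_eval (d := 1) one_pos P hPeq

end Refutation

end Literature.MathematicalPhysics.QuantumLattice
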